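import Mathlib
import Summits.CriticalPhenomena.PercolationContinuityZ3.Theorems.PercNearOneGluingNoHeavyLowerTailPendantStarGluing
import Summits.CriticalPhenomena.PercolationContinuityZ3.Theses.PercNearOneGluingNoHeavy
import HarnessLib

/-!
# `NearOneGluing` (stmt-CriticalPhenomena-4574) ⟺ its OFF-OBSERVER form: Kozma–Nitzan's Conjecture 3 may
# assume the relays are reliable to the target WITHOUT the observer

Support file (depth prover `nh-dp-blobmono`, respawn g5; `--supports stmt-CriticalPhenomena-4575` — the two
open items of the route are equivalent engines, `Theorems.noHeavyLowerTailGlue_proof`).  No definitions, no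
named facts, no sorries.

Kozma–Nitzan's Conjecture 3 (`Theses.PercNearOneGluingNoHeavy.NearOneGluing`, arXiv:2401.12397 p. 15): for
every `ε > 0` there is `δ > 0` such that `μ(o ↔ A) > 1 − δ` and `μ(a ↔ b) > 1 − δ` for all `a ∈ A` force
`μ(o ↔ b) > 1 − ε`.  Its OFF-OBSERVER ("`H`-reliability", `H = G − o`) form asks the same conclusion under the
STRONGER hypothesis `μ_{G−o}(a ↔ b) > 1 − δ` (the law with every pair at `o` given weight `0`), i.e. it is a
formally WEAKER statement — the relays are reliable to `b` without any help from `o`; this is the reference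
graph of Kozma–Nitzan's Question 9 (p. 36) and of every "goodness" argument (Thms 4, 5, 8), and the lead's
'Conjecture 3H' (LEAD-GEN5 §4b), whose compatibility with the `θ(p_c)` reduction (KN Thm 6) was unclear.

* `nearOneGluing_of_offObserver` — **the off-observer form implies `NearOneGluing`** (with `δ ↦ min(δ, εδ, ε, ½)`):
  by the observer bridge `μ(o ↮ b)·μ_{G−o}(a ↮ b) ≤ μ(a ↮ b)` (`Theorems.observerBridge`, Harris), either
  every relay is `δ`-reliable in `G − o` — and the off-observer statement applies — or some relay `a*` has
  `μ_{G−o}(a* ↮ b) ≥ δ` and then `μ(o ↮ b) ≤ μ(a* ↮ b)/δ < ε` outright.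
* `offObserver_of_nearOneGluing` — the converse (monotonicity of `μ(a ↔ b)` in the weights).
So the two are EQUIVALENT: in Conjecture 3 one may assume, at no cost beyond `δ ↦ δ²`-type losses, that
deleting the observer does not hurt the relays.  No need to re-run KN's Theorem 6 under `H`-reliability.
-/

namespace Summit.CriticalPhenomena.PercolationContinuityZ3.Theorems

open MeasureTheory Set
open Literature.Probability.LatticeModels (prodBernoulli prodBernoulli_real_mono_of_isUpperSet)
open Literature.Probability.Percolation (BondConfig openConn isUpperSet_openConn)

noncomputable section
open Classical

/-- **The off-observer form of Kozma–Nitzan's Conjecture 3 implies the conjecture.**  Hypothesis: for every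
`ε > 0` some `δ > 0` works for all graphs, relay sets, observers `o ∉ A` and targets `b` whose relays are
`δ`-reliable to `b` in `G − o` (pairs at `o` given weight `0`).  Conclusion: `NearOneGluing`.
[this work; cite: KozmaNitzan2024, Conjecture 3 (p. 15), Question 9 (p. 36)] -/
theorem nearOneGluing_of_offObserver
    (h : ∀ ε : ℝ, 0 < ε → ∃ δ : ℝ, 0 < δ ∧ ∀ (n : ℕ) (w : Sym2 (Fin n) → unitInterval) (A : Finset (Fin n))
      (o b : Fin n), o ∉ A →
      1 - δ < (prodBernoulli w).real (⋃ a ∈ A, openConn o a) →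
      (∀ a ∈ A, 1 - δ < (prodBernoulli (fun e : Sym2 (Fin n) =>
        if (∃ x ∈ e, x ∈ ({o} : Finset (Fin n))) then 0 else w e)).real (openConn a b)) →
      1 - ε < (prodBernoulli w).real (openConn o b)) :
    Theses.PercNearOneGluingNoHeavy.NearOneGluing := by
  intro ε hε
  obtain ⟨δ₁, hδ₁, H⟩ := h ε hε
  refine ⟨min (min δ₁ (ε * δ₁)) (min ε (1/2)), ?_, ?_⟩
  · exact lt_min (lt_min hδ₁ (mul_pos hε hδ₁)) (lt_min hε (by norm_num))
  intro n w A o b hoA hrel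
  set δ : ℝ := min (min δ₁ (ε * δ₁)) (min ε (1/2)) with hδdef
  have hδ1 : δ ≤ δ₁ := le_trans (min_le_left _ _) (min_le_left _ _)
  have hδ2 : δ ≤ ε * δ₁ := le_trans (min_le_left _ _) (min_le_right _ _)
  have hδ3 : δ ≤ ε := le_trans (min_le_right _ _) (min_le_left _ _)
  have hδ4 : δ ≤ 1/2 := le_trans (min_le_right _ _) (min_le_right _ _)
  set μ := prodBernoulli w with hμ
  set kw : Sym2 (Fin n) → unitInterval :=
    fun e => if (∃ x ∈ e, x ∈ ({o} : Finset (Fin n))) then 0 else w e with hkw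
  -- `A` is nonempty
  have hAne : A.Nonempty := by
    rw [Finset.nonempty_iff_ne_empty]
    rintro rfl
    simp only [Finset.notMem_empty, Set.iUnion_of_empty, Set.iUnion_empty, measureReal_empty] at hoA
    linarith
  -- the case `o ∈ A` is immediate from the relay hypothesis at `a = o`
  by_cases hoA' : o ∈ A
  · have := hrel o hoA'
    linarith
  -- the worst relay without `o`
  obtain ⟨aStar, haStar, hmax⟩ := Finset.exists_max_image A
    (fun a => (prodBernoulli kw).real (openConn a b)ᶜ) hAne
  set θ : ℝ := (prodBernoulli kw).real (openConn aStar b)ᶜ with hθ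
  by_cases hθδ : θ < δ₁
  · -- every relay is `δ₁`-reliable off `o`: apply the off-observer statement
    refine H n w A o b hoA' (lt_of_le_of_lt (by linarith) hoA) fun a ha => ?_
    have hle : (prodBernoulli kw).real (openConn a b)ᶜ ≤ θ := hmax a ha
    rw [probReal_compl_eq_one_sub (pocketGlue_measurableSet _)] at hle
    have hθ' : θ < δ₁ := hθδ
    linarith
  · -- some relay is `δ₁`-unreliable off `o`: the bridge bounds `μ(o ↮ b)` outright
    push Not at hθδ
    have haStaro : aStar ≠ o := fun h' => hoA' (h' ▸ haStar)
    have hbridge := observerBridge w o aStar b haStaro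
    have hrelStar : μ.real (openConn aStar b)ᶜ < δ := by
      rw [probReal_compl_eq_one_sub (pocketGlue_measurableSet _)]
      have := hrel aStar haStar
      linarith
    have hob : μ.real (openConn o b)ᶜ * δ₁ ≤ μ.real (openConn o b)ᶜ * θ :=
      mul_le_mul_of_nonneg_left hθδ measureReal_nonneg
    have h1 : μ.real (openConn o b)ᶜ * δ₁ < ε * δ₁ := by
      calc μ.real (openConn o b)ᶜ * δ₁ ≤ μ.real (openConn o b)ᶜ * θ := hob
        _ ≤ μ.real (openConn aStar b)ᶜ := hbridge
        _ < δ := hrelStar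
        _ ≤ ε * δ₁ := hδ2
    have h2 : μ.real (openConn o b)ᶜ < ε := lt_of_mul_lt_mul_right h1 hδ₁.le
    rw [probReal_compl_eq_one_sub (pocketGlue_measurableSet _)] at h2
    linarith

/-- The converse: `NearOneGluing` implies its off-observer form (relays reliable off `o` are reliable).
[this work] -/
theorem offObserver_of_nearOneGluing (h : Theses.PercNearOneGluingNoHeavy.NearOneGluing) :
    ∀ ε : ℝ, 0 < ε → ∃ δ : ℝ, 0 < δ ∧ ∀ (n : ℕ) (w : Sym2 (Fin n) → unitInterval) (A : Finset (Fin n))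
      (o b : Fin n), o ∉ A →
      1 - δ < (prodBernoulli w).real (⋃ a ∈ A, openConn o a) →
      (∀ a ∈ A, 1 - δ < (prodBernoulli (fun e : Sym2 (Fin n) =>
        if (∃ x ∈ e, x ∈ ({o} : Finset (Fin n))) then 0 else w e)).real (openConn a b)) →
      1 - ε < (prodBernoulli w).real (openConn o b) := by
  intro ε hε
  obtain ⟨δ, hδ, H⟩ := h ε hε
  refine ⟨δ, hδ, fun n w A o b _ hoA hrel => H n w A o b hoA fun a ha => ?_⟩
  have hle : (fun e : Sym2 (Fin n) => if (∃ x ∈ e, x ∈ ({o} : Finset (Fin n))) then (0 : unitInterval)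
      else w e) ≤ w := by
    intro e
    show (if (∃ x ∈ e, x ∈ ({o} : Finset (Fin n))) then (0 : unitInterval) else w e) ≤ w e
    split_ifs
    · exact unitInterval.nonneg'
    · exact le_rfl
  exact lt_of_lt_of_le (hrel a ha)
    (prodBernoulli_real_mono_of_isUpperSet hle (isUpperSet_openConn a b) (pocketGlue_measurableSet _))

end

end Summit.CriticalPhenomena.PercolationContinuityZ3.Theorems
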